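/-
Copyright: the b2b-balaban T⁴-continuum CRUX team, row NE7b OWNER lineage `t4-ne7b-p1` (gen 130). Project licence.
-/
import Summits.QuantumFields.BalabanUV.T4Continuum.Spine.NE7b.SupExpFamilyLogDerivatives

/-!
# THE CUMULANTS OF THE EXPONENTIAL FAMILY ARE BOUNDED BY TILTED ABSOLUTE MOMENTS: for a NONNEGATIVE weight `Φ₀` and `H = I[1] > 0`, with
# `⟨X⟩ = I[X]∕I[1]` and `m_X ≥ ⟨|X|⟩`,
#   `|∂_s²log H| ≤ m_{A²} + m_A²`,   `|∂_t∂_slog H| ≤ m_{AB} + m_Am_B`,   `|∂_t²∂_slog H| ≤ m_{AB²} + m_Am_{B²} + 2m_{AB}m_B + 2m_Am_B²`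
# for the closed forms of (330) — `|I[X]| ≤ I[|X|]` and real algebra; the letters `m_X` are what the road's single-site moments ((323))
# supply (row NE7b, node U5c; (330) BY NAME + Mathlib's `abs_integral_le_integral_abs`; [folklore])

Cell `pub-balaban`, sub-cell `t4`, spine estimate NE7b (`T4WeightBudget.RelWeightBound`; the cell's OWN estimate — NOT PRINTED in
[Bałaban 1983–89], NOT PROVED).  Crux-route work under `Spine/NE7b/` by the row OWNER (`t4-ne7b-p1` gen 130, file (331)) under FREEZE
(0)'s crux-prover clause, on § [NE7bP1-G129-HANDOFF] NEXT (i)∕(ii) (SCOPING-d4: the `M₂, M₃` letters of (327)); NOTHING of Bałaban's is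
named as a Lean object, valued or asserted; no `T4Continuum/Support` leaf typed; no `def`, no notation; zero `sorry`.  Imports (BY NAME):
(330) `…SupExpFamilyLogDerivatives` (vocabulary only); Mathlib's `abs_integral_le_integral_abs`, `integral_nonneg`, `div_le_div_of_nonneg_right`.

WHAT IS PROVED ([folklore]; real algebra in §1, integrals in §2):
* §1 `abs_var_quot_le` (`h > 0`, `|a| ≤ h·m_A`, `0 ≤ aa ≤ h·m_{AA}` ⟹ `|(aa·h − a·a)∕h²| ≤ m_{AA} + m_A²`), `abs_cov_quot_le`
  (`|(ab·h − a·b)∕h²| ≤ m_{AB} + m_Am_B`), **`abs_third_quot_le`** (the raw quotient-rule expression of (330)'s `hasDerivAt_fst_t` is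
  `≤ m_{ABB} + m_Am_{BB} + 2m_{AB}m_B + 2m_Am_B²`);
* §2 `abs_tiltedIntegral_le` (`Φ₀ ≥ 0` ⟹ `|∫Φ₀Xe^{sA+tB}| ≤ ∫Φ₀|X|e^{sA+tB}`), THE END **`abs_fss_le`**, **`abs_fst_le`**, **`abs_fstt_le`**
  (the three displayed bounds for the closed forms of (330), given the six moment letters at the point `(s,t)`); §3 toy.

HONEST (what this is NOT).  Bounds at one point `(s,t)` from moment letters supplied as hypotheses; the road's discharge of the letters
(single-site Gaussian moments of the tilted law of the perturbed family, uniformly on the unit square) and the assembly with (326)∕(327) are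
the last file of SCOPING-d4; nothing of Bałaban's asserted.  BY-NAME EFFECT ON THE WALL: NONE.  NE7b NOT PRINTED ∕ NOT PROVED; spine PROVED
0∕9; rung (B)+1 — the programme's measures remain FINITE-torus statements; NOT the mass gap, NOT Clay.  HONEST DEPENDENCY: continuum YM on
T⁴ ⇐ BetaPertH ∧ nine spine estimates (0∕9 proved); BetaPertH ⇐ (D1) ∧ (D4) ∧ CAP+tail; G-an2-4 gates asym, D1 and NE2∕3∕4.
-/

set_option autoImplicit false

noncomputable section

namespace Summit.QuantumFields.BalabanUV.T4Continuum.NE7b.SupExpFamilyCumulantBounds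

open MeasureTheory Real Set

/-! ## §1. Real algebra: quotients of the quotient rule against moment letters -/

/-- `h > 0`, `|a| ≤ h·m` ⟹ `|a|∕h ≤ m` and `|a∕h| ≤ m`. [folklore] -/
theorem abs_div_le_of_abs_le {h a m : ℝ} (hh : 0 < h) (ha : |a| ≤ h * m) : |a / h| ≤ m := by
  rw [abs_div, abs_of_pos hh, div_le_iff₀ hh, mul_comm]
  exact ha

/-- **VARIANCE-TYPE QUOTIENT**: `h > 0`, `|a| ≤ h·m_A`, `|aa| ≤ h·m_{AA}`, `0 ≤ m_A` ⟹ `|(aa·h − a·a)∕h²| ≤ m_{AA} + m_A²`. [folklore] -/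
theorem abs_var_quot_le {h a aa mA mAA : ℝ} (hh : 0 < h) (hmA : 0 ≤ mA) (ha : |a| ≤ h * mA) (haa : |aa| ≤ h * mAA) :
    |(aa * h - a * a) / h ^ 2| ≤ mAA + mA ^ 2 := by
  have h1 : |a / h| ≤ mA := abs_div_le_of_abs_le hh ha
  have h2 : |aa / h| ≤ mAA := abs_div_le_of_abs_le hh haa
  have e : (aa * h - a * a) / h ^ 2 = aa / h - (a / h) * (a / h) := by
    field_simp
  rw [e]
  calc |aa / h - a / h * (a / h)| ≤ |aa / h| + |a / h * (a / h)| := abs_sub _ _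
    _ = |aa / h| + |a / h| * |a / h| := by rw [abs_mul]
    _ ≤ mAA + mA * mA := add_le_add h2 (mul_le_mul h1 h1 (abs_nonneg _) hmA)
    _ = mAA + mA ^ 2 := by ring

/-- **COVARIANCE-TYPE QUOTIENT**: `h > 0`, `|a| ≤ h·m_A`, `|b| ≤ h·m_B`, `|ab| ≤ h·m_{AB}`, `0 ≤ m_A` ⟹ `|(ab·h − a·b)∕h²| ≤ m_{AB} + m_Am_B`.
[folklore] -/
theorem abs_cov_quot_le {h a b ab mA mB mAB : ℝ} (hh : 0 < h) (hmA : 0 ≤ mA) (ha : |a| ≤ h * mA) (hb : |b| ≤ h * mB)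
    (hab : |ab| ≤ h * mAB) : |(ab * h - a * b) / h ^ 2| ≤ mAB + mA * mB := by
  have h1 : |a / h| ≤ mA := abs_div_le_of_abs_le hh ha
  have h2 : |b / h| ≤ mB := abs_div_le_of_abs_le hh hb
  have h3 : |ab / h| ≤ mAB := abs_div_le_of_abs_le hh hab
  have e : (ab * h - a * b) / h ^ 2 = ab / h - (a / h) * (b / h) := by
    field_simp
  rw [e]
  calc |ab / h - a / h * (b / h)| ≤ |ab / h| + |a / h * (b / h)| := abs_sub _ _
    _ = |ab / h| + |a / h| * |b / h| := by rw [abs_mul]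
    _ ≤ mAB + mA * mB := add_le_add h3 (mul_le_mul h1 h2 (abs_nonneg _) hmA)

/-- **THIRD-CUMULANT QUOTIENT** (the raw form produced by the quotient rule in (330) `hasDerivAt_fst_t`): `h > 0` and the six letters
`|a| ≤ hm_A`, `|b| ≤ hm_B`, `|ab| ≤ hm_{AB}`, `|bb| ≤ hm_{BB}`, `|abb| ≤ hm_{ABB}` (`m_A, m_B, m_{AB} ≥ 0`) ⟹
`|((abb·h + ab·b − (ab·b + a·bb))·h² − (ab·h − a·b)·(2·h·b))∕(h²)²| ≤ m_{ABB} + m_Am_{BB} + 2m_{AB}m_B + 2m_Am_B²`. [folklore] -/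
theorem abs_third_quot_le {h a b ab bb abb mA mB mAB mBB mABB : ℝ} (hh : 0 < h) (hmA : 0 ≤ mA) (hmB : 0 ≤ mB) (hmAB : 0 ≤ mAB)
    (ha : |a| ≤ h * mA) (hb : |b| ≤ h * mB) (hab : |ab| ≤ h * mAB) (hbb : |bb| ≤ h * mBB) (habb : |abb| ≤ h * mABB) :
    |((abb * h + ab * b - (ab * b + a * bb)) * h ^ 2 - (ab * h - a * b) * (2 * h * b)) / (h ^ 2) ^ 2| ≤
      mABB + mA * mBB + 2 * mAB * mB + 2 * mA * mB ^ 2 := by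
  have h1 : |a / h| ≤ mA := abs_div_le_of_abs_le hh ha
  have h2 : |b / h| ≤ mB := abs_div_le_of_abs_le hh hb
  have h3 : |ab / h| ≤ mAB := abs_div_le_of_abs_le hh hab
  have h4 : |bb / h| ≤ mBB := abs_div_le_of_abs_le hh hbb
  have h5 : |abb / h| ≤ mABB := abs_div_le_of_abs_le hh habb
  have e : ((abb * h + ab * b - (ab * b + a * bb)) * h ^ 2 - (ab * h - a * b) * (2 * h * b)) / (h ^ 2) ^ 2 =
      abb / h - (a / h) * (bb / h) - 2 * (ab / h) * (b / h) + 2 * (a / h) * ((b / h) * (b / h)) := by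
    field_simp
    ring
  rw [e]
  have hA0 := abs_nonneg (a / h)
  have hB0 := abs_nonneg (b / h)
  have t1 : |a / h * (bb / h)| ≤ mA * mBB := by
    rw [abs_mul]; exact mul_le_mul h1 h4 (abs_nonneg _) hmA
  have t2 : |2 * (ab / h) * (b / h)| ≤ 2 * mAB * mB := by
    rw [abs_mul, abs_mul, abs_two]
    exact mul_le_mul (mul_le_mul_of_nonneg_left h3 zero_le_two) h2 (abs_nonneg _) (by positivity)
  have t3 : |2 * (a / h) * (b / h * (b / h))| ≤ 2 * mA * mB ^ 2 := by
    rw [abs_mul, abs_mul, abs_mul, abs_two, sq]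
    exact mul_le_mul (mul_le_mul_of_nonneg_left h1 zero_le_two) (mul_le_mul h2 h2 hB0 hmB) (by positivity) (by positivity)
  calc |abb / h - a / h * (bb / h) - 2 * (ab / h) * (b / h) + 2 * (a / h) * (b / h * (b / h))|
      ≤ |abb / h - a / h * (bb / h) - 2 * (ab / h) * (b / h)| + |2 * (a / h) * (b / h * (b / h))| := abs_add_le _ _
    _ ≤ |abb / h - a / h * (bb / h)| + |2 * (ab / h) * (b / h)| + |2 * (a / h) * (b / h * (b / h))| := by
        linarith [abs_sub (abb / h - a / h * (bb / h)) (2 * (ab / h) * (b / h))]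
    _ ≤ |abb / h| + |a / h * (bb / h)| + |2 * (ab / h) * (b / h)| + |2 * (a / h) * (b / h * (b / h))| := by
        linarith [abs_sub (abb / h) (a / h * (bb / h))]
    _ ≤ mABB + mA * mBB + 2 * mAB * mB + 2 * mA * mB ^ 2 := by linarith

/-! ## §2. Integrals: `|I[X]| ≤ I[|X|]` for a nonnegative weight, and the three cumulant bounds -/

variable {Ω : Type*} [MeasurableSpace Ω] {μ : Measure Ω} {Φ₀ A B : Ω → ℝ}

/-- **`|I[X]| ≤ I[|X|]`** for a nonnegative weight: `|∫Φ₀Xe^{sA+tB}dμ| ≤ ∫Φ₀|X|e^{sA+tB}dμ`. [folklore] -/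
theorem abs_tiltedIntegral_le (hΦ₀ : ∀ ω, 0 ≤ Φ₀ ω) (X : Ω → ℝ) (s t : ℝ) :
    |∫ ω, Φ₀ ω * X ω * exp (s * A ω + t * B ω) ∂μ| ≤ ∫ ω, Φ₀ ω * |X ω| * exp (s * A ω + t * B ω) ∂μ := by
  refine abs_integral_le_integral_abs.trans (le_of_eq (integral_congr_ae (ae_of_all _ fun ω => ?_)))
  dsimp only
  rw [abs_mul, abs_mul, abs_of_nonneg (hΦ₀ ω), abs_of_pos (exp_pos _)]

/-- **`|∂_s²log H| ≤ m_{A²} + m_A²`**: the closed form of (330) `hasDerivAt_fs_s` against the letters `I[|A|] ≤ H·m_A`, `I[A·A] ≤ H·m_{AA}`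
(`Φ₀ ≥ 0`, `H > 0`). [folklore] -/
theorem abs_fss_le (hΦ₀ : ∀ ω, 0 ≤ Φ₀ ω) {s t mA mAA : ℝ} (hH : 0 < ∫ ω, Φ₀ ω * exp (s * A ω + t * B ω) ∂μ) (hmA : 0 ≤ mA)
    (hA : ∫ ω, Φ₀ ω * |A ω| * exp (s * A ω + t * B ω) ∂μ ≤ (∫ ω, Φ₀ ω * exp (s * A ω + t * B ω) ∂μ) * mA)
    (hAA : ∫ ω, Φ₀ ω * |A ω * A ω| * exp (s * A ω + t * B ω) ∂μ ≤ (∫ ω, Φ₀ ω * exp (s * A ω + t * B ω) ∂μ) * mAA) :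
    |((∫ ω, Φ₀ ω * A ω * A ω * exp (s * A ω + t * B ω) ∂μ) * (∫ ω, Φ₀ ω * exp (s * A ω + t * B ω) ∂μ) -
        (∫ ω, Φ₀ ω * A ω * exp (s * A ω + t * B ω) ∂μ) * (∫ ω, Φ₀ ω * A ω * exp (s * A ω + t * B ω) ∂μ)) /
        (∫ ω, Φ₀ ω * exp (s * A ω + t * B ω) ∂μ) ^ 2| ≤ mAA + mA ^ 2 := by
  have hAA' : |∫ ω, Φ₀ ω * A ω * A ω * exp (s * A ω + t * B ω) ∂μ| ≤ (∫ ω, Φ₀ ω * exp (s * A ω + t * B ω) ∂μ) * mAA := by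
    have h := abs_tiltedIntegral_le (μ := μ) (A := A) (B := B) hΦ₀ (fun ω => A ω * A ω) s t
    have e : ∫ ω, Φ₀ ω * A ω * A ω * exp (s * A ω + t * B ω) ∂μ = ∫ ω, Φ₀ ω * (A ω * A ω) * exp (s * A ω + t * B ω) ∂μ :=
      integral_congr_ae (ae_of_all _ fun ω => by dsimp only; rw [mul_assoc (Φ₀ ω)])
    rw [e]
    exact h.trans hAA
  exact abs_var_quot_le hH hmA ((abs_tiltedIntegral_le hΦ₀ A s t).trans hA) hAA'

/-- **`|∂_t∂_slog H| ≤ m_{AB} + m_Am_B`**: the closed form of (330) `hasDerivAt_fs_t` against the letters for `|A|, |B|, |AB|`. [folklore] -/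
theorem abs_fst_le (hΦ₀ : ∀ ω, 0 ≤ Φ₀ ω) {s t mA mB mAB : ℝ} (hH : 0 < ∫ ω, Φ₀ ω * exp (s * A ω + t * B ω) ∂μ) (hmA : 0 ≤ mA)
    (hA : ∫ ω, Φ₀ ω * |A ω| * exp (s * A ω + t * B ω) ∂μ ≤ (∫ ω, Φ₀ ω * exp (s * A ω + t * B ω) ∂μ) * mA)
    (hB : ∫ ω, Φ₀ ω * |B ω| * exp (s * A ω + t * B ω) ∂μ ≤ (∫ ω, Φ₀ ω * exp (s * A ω + t * B ω) ∂μ) * mB)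
    (hAB : ∫ ω, Φ₀ ω * |A ω * B ω| * exp (s * A ω + t * B ω) ∂μ ≤ (∫ ω, Φ₀ ω * exp (s * A ω + t * B ω) ∂μ) * mAB) :
    |((∫ ω, Φ₀ ω * A ω * B ω * exp (s * A ω + t * B ω) ∂μ) * (∫ ω, Φ₀ ω * exp (s * A ω + t * B ω) ∂μ) -
        (∫ ω, Φ₀ ω * A ω * exp (s * A ω + t * B ω) ∂μ) * (∫ ω, Φ₀ ω * B ω * exp (s * A ω + t * B ω) ∂μ)) /
        (∫ ω, Φ₀ ω * exp (s * A ω + t * B ω) ∂μ) ^ 2| ≤ mAB + mA * mB := by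
  have hAB' : |∫ ω, Φ₀ ω * A ω * B ω * exp (s * A ω + t * B ω) ∂μ| ≤ (∫ ω, Φ₀ ω * exp (s * A ω + t * B ω) ∂μ) * mAB := by
    have h := abs_tiltedIntegral_le (μ := μ) (A := A) (B := B) hΦ₀ (fun ω => A ω * B ω) s t
    have e : ∫ ω, Φ₀ ω * A ω * B ω * exp (s * A ω + t * B ω) ∂μ = ∫ ω, Φ₀ ω * (A ω * B ω) * exp (s * A ω + t * B ω) ∂μ :=
      integral_congr_ae (ae_of_all _ fun ω => by dsimp only; rw [mul_assoc (Φ₀ ω)])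
    rw [e]
    exact h.trans hAB
  exact abs_cov_quot_le hH hmA ((abs_tiltedIntegral_le hΦ₀ A s t).trans hA) ((abs_tiltedIntegral_le hΦ₀ B s t).trans hB) hAB'

/-- **THE END — `|∂_t²∂_slog H| ≤ m_{AB²} + m_Am_{B²} + 2m_{AB}m_B + 2m_Am_B²`**: the raw closed form of (330) `hasDerivAt_fst_t` against the
six moment letters at `(s,t)` (`Φ₀ ≥ 0`, `H > 0`, `m_A, m_B, m_{AB} ≥ 0`). [folklore] -/
theorem abs_fstt_le (hΦ₀ : ∀ ω, 0 ≤ Φ₀ ω) {s t mA mB mAB mBB mABB : ℝ} (hH : 0 < ∫ ω, Φ₀ ω * exp (s * A ω + t * B ω) ∂μ)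
    (hmA : 0 ≤ mA) (hmB : 0 ≤ mB) (hmAB : 0 ≤ mAB)
    (hA : ∫ ω, Φ₀ ω * |A ω| * exp (s * A ω + t * B ω) ∂μ ≤ (∫ ω, Φ₀ ω * exp (s * A ω + t * B ω) ∂μ) * mA)
    (hB : ∫ ω, Φ₀ ω * |B ω| * exp (s * A ω + t * B ω) ∂μ ≤ (∫ ω, Φ₀ ω * exp (s * A ω + t * B ω) ∂μ) * mB)
    (hAB : ∫ ω, Φ₀ ω * |A ω * B ω| * exp (s * A ω + t * B ω) ∂μ ≤ (∫ ω, Φ₀ ω * exp (s * A ω + t * B ω) ∂μ) * mAB)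
    (hBB : ∫ ω, Φ₀ ω * |B ω * B ω| * exp (s * A ω + t * B ω) ∂μ ≤ (∫ ω, Φ₀ ω * exp (s * A ω + t * B ω) ∂μ) * mBB)
    (hABB : ∫ ω, Φ₀ ω * |A ω * B ω * B ω| * exp (s * A ω + t * B ω) ∂μ ≤ (∫ ω, Φ₀ ω * exp (s * A ω + t * B ω) ∂μ) * mABB) :
    abs
      ((((∫ ω, Φ₀ ω * A ω * B ω * B ω * exp (s * A ω + t * B ω) ∂μ) * (∫ ω, Φ₀ ω * exp (s * A ω + t * B ω) ∂μ) +
          (∫ ω, Φ₀ ω * A ω * B ω * exp (s * A ω + t * B ω) ∂μ) * (∫ ω, Φ₀ ω * B ω * exp (s * A ω + t * B ω) ∂μ) -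
          ((∫ ω, Φ₀ ω * A ω * B ω * exp (s * A ω + t * B ω) ∂μ) * (∫ ω, Φ₀ ω * B ω * exp (s * A ω + t * B ω) ∂μ) +
            (∫ ω, Φ₀ ω * A ω * exp (s * A ω + t * B ω) ∂μ) * (∫ ω, Φ₀ ω * B ω * B ω * exp (s * A ω + t * B ω) ∂μ))) *
          (∫ ω, Φ₀ ω * exp (s * A ω + t * B ω) ∂μ) ^ 2 -
        ((∫ ω, Φ₀ ω * A ω * B ω * exp (s * A ω + t * B ω) ∂μ) * (∫ ω, Φ₀ ω * exp (s * A ω + t * B ω) ∂μ) -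
          (∫ ω, Φ₀ ω * A ω * exp (s * A ω + t * B ω) ∂μ) * (∫ ω, Φ₀ ω * B ω * exp (s * A ω + t * B ω) ∂μ)) *
          (2 * (∫ ω, Φ₀ ω * exp (s * A ω + t * B ω) ∂μ) * (∫ ω, Φ₀ ω * B ω * exp (s * A ω + t * B ω) ∂μ))) /
        ((∫ ω, Φ₀ ω * exp (s * A ω + t * B ω) ∂μ) ^ 2) ^ 2) ≤ mABB + mA * mBB + 2 * mAB * mB + 2 * mA * mB ^ 2 := by
  have hprod : ∀ X : Ω → ℝ, ∀ m : ℝ, (∫ ω, Φ₀ ω * |X ω| * exp (s * A ω + t * B ω) ∂μ ≤ (∫ ω, Φ₀ ω * exp (s * A ω + t * B ω) ∂μ) * m) →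
      |∫ ω, Φ₀ ω * X ω * exp (s * A ω + t * B ω) ∂μ| ≤ (∫ ω, Φ₀ ω * exp (s * A ω + t * B ω) ∂μ) * m :=
    fun X m hX => (abs_tiltedIntegral_le hΦ₀ X s t).trans hX
  have eAB : ∫ ω, Φ₀ ω * A ω * B ω * exp (s * A ω + t * B ω) ∂μ = ∫ ω, Φ₀ ω * (A ω * B ω) * exp (s * A ω + t * B ω) ∂μ :=
    integral_congr_ae (ae_of_all _ fun ω => by dsimp only; rw [mul_assoc (Φ₀ ω)])
  have eBB : ∫ ω, Φ₀ ω * B ω * B ω * exp (s * A ω + t * B ω) ∂μ = ∫ ω, Φ₀ ω * (B ω * B ω) * exp (s * A ω + t * B ω) ∂μ :=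
    integral_congr_ae (ae_of_all _ fun ω => by dsimp only; rw [mul_assoc (Φ₀ ω)])
  have eABB : ∫ ω, Φ₀ ω * A ω * B ω * B ω * exp (s * A ω + t * B ω) ∂μ =
      ∫ ω, Φ₀ ω * (A ω * B ω * B ω) * exp (s * A ω + t * B ω) ∂μ :=
    integral_congr_ae (ae_of_all _ fun ω => by dsimp only; rw [mul_assoc (Φ₀ ω), mul_assoc (Φ₀ ω)])
  rw [eAB, eBB, eABB]
  exact abs_third_quot_le hH hmA hmB hmAB (hprod A mA hA) (hprod B mB hB) (hprod _ mAB hAB) (hprod _ mBB hBB) (hprod _ mABB hABB)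

/-! ## §3. Toy -/

/-- Toy (§1): `h = 1`, `a = 2`, `m = 2`: `|2∕1| ≤ 2`. -/
example : abs ((2 : ℝ) / 1) ≤ 2 := abs_div_le_of_abs_le (a := 2) one_pos (by rw [abs_two, one_mul])

end Summit.QuantumFields.BalabanUV.T4Continuum.NE7b.SupExpFamilyCumulantBounds
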